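import Mathlib

/-!
# LINE LAW — the gcd hypothesis of the one-sided bookkeeping holds on every reached line (ENGINE-W code B, #B15)

LEMMA P (ii) of LINE-LAW-THEOREMS-B.md: on a line reached at winding `T` with datum `A`, for a weight `c` with
`T = c · n` (`n = T/c` the norm of the dividing element `z_c`), the form `(n, 2A, k)` with `n k = A² - m` is primitive
(the principal ideal `(z_c) = (n, -A + √m)` is invertible; stated as: every common divisor of `n, 2A, k` is a unit), and `T ∣ A² - m` (LEMMA P (i)).  Then NO prime divides
`n`, `c` and `2A` simultaneously — which is exactly the hypothesis `gcd(n₁, n₂, 2A) = 1` of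
`LineLawIdealProduct.primIdeal_mul_of_gcd` (#B14) for the factorisation `𝔞_{T/c}(A) · 𝔞_c(A) = 𝔞_T(A)` used in
THEOREM E «⇒».  The proof is one line: `c n ∣ n k` gives `c ∣ k`, so a common prime of `n, c, 2A` divides
`gcd(n, 2A, k) = 1`.  No squarefree hypothesis on `m` (REF-W ROW 359, rider P-NSQ-1).
Honest framing: integer arithmetic only; Mukai vectors and lattices elsewhere, not objects; nothing here says that
HC, HC_CM or HC_AV holds.
-/

namespace HSemireg.LineLawProperness

/-- LEMMA P (ii): if `T = c n`, `n k = A² - m`, `T ∣ A² - m`, `n ≠ 0` and the form `(n, 2A, k)` is primitive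
(every common divisor of `n, 2A, k` is a unit), then no prime `q` divides `n`, `c` and `2A`. -/
theorem no_common_prime {T c n k A m q : ℤ} (hT : T = c * n) (hk : n * k = A * A - m)
    (hdiv : T ∣ A * A - m) (hn : n ≠ 0) (hprim : ∀ d : ℤ, d ∣ n → d ∣ 2 * A → d ∣ k → IsUnit d)
    (hq : Prime q) (h1 : q ∣ n) (h2 : q ∣ c) (h3 : q ∣ 2 * A) : False := by
  -- `c n ∣ n k`, hence `c ∣ k`, hence `q ∣ k`
  have hck : c ∣ k := by
    have : n * c ∣ n * k := by
      have e : n * c = T := by rw [hT]; ring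
      rw [e, hk]; exact hdiv
    exact (mul_dvd_mul_iff_left hn).1 this
  exact hq.not_unit (hprim q h1 h3 (dvd_trans h2 hck))

/-- The same conclusion phrased as the #B14 hypothesis `gcd (gcd n c) (2A) = 1`. -/
theorem gcd_hypothesis {T c n k A m : ℤ} (hT : T = c * n) (hk : n * k = A * A - m)
    (hdiv : T ∣ A * A - m) (hn : n ≠ 0) (hprim : ∀ d : ℤ, d ∣ n → d ∣ 2 * A → d ∣ k → IsUnit d) :
    Int.gcd (Int.gcd n c : ℤ) (2 * A) = 1 := by
  by_contra hne
  obtain ⟨p, hp, hpg⟩ := Nat.exists_prime_and_dvd hne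
  have hpZ : (p : ℤ) ∣ ((Int.gcd (Int.gcd n c : ℤ) (2 * A) : ℕ) : ℤ) := by exact_mod_cast hpg
  have hg1 : (((Int.gcd (Int.gcd n c : ℤ) (2 * A)) : ℕ) : ℤ) ∣ ((Int.gcd n c : ℕ) : ℤ) := Int.gcd_dvd_left _ _
  have hg2 : (((Int.gcd (Int.gcd n c : ℤ) (2 * A)) : ℕ) : ℤ) ∣ 2 * A := Int.gcd_dvd_right _ _
  have hpn : (p : ℤ) ∣ n := dvd_trans (dvd_trans hpZ hg1) (Int.gcd_dvd_left _ _)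
  have hpc : (p : ℤ) ∣ c := dvd_trans (dvd_trans hpZ hg1) (Int.gcd_dvd_right _ _)
  have hpA : (p : ℤ) ∣ 2 * A := dvd_trans hpZ hg2
  exact no_common_prime hT hk hdiv hn hprim (Nat.prime_iff_prime_int.1 hp) hpn hpc hpA

end HSemireg.LineLawProperness
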